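import Literature.Algebra.GroupRings.VonNeumannRegularGroupRings
import Literature.RingTheory.JacobsonRadical.VonNeumannRegularSummands
import Mathlib.RingTheory.Finiteness.Basic
import HarnessLib

/-!
# Lam §6 Exercise 6.21, «if» for an arbitrary von Neumann regular coefficient ring, and the full characterisation

[cite: Lam2001FirstCourse, §6 Exercise 6.21, p. 99]

Lam, *A First Course in Noncommutative Rings*, Exercises for §6 (p. 99): **Ex. 6.21.** (Auslander, McLaughlin, Connell) For any nonzero
ring `k` and any group `G`, the group ring `kG` is von Neumann regular iff `k` is von Neumann regular, `G` is locally finite, and the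
order of any finite subgroup of `G` is a unit in `k`. «The "if" part can be deduced from Exercise 19 and (1) of Exercise 3.»

The file `VonNeumannRegularGroupRings` has the «only if» half and the «if» half for semisimple `k`; with Exercise 6.19 now in the tree
(`VonNeumannRegularSummands.exists_isCompl_of_fg_of_basis`) this file completes the printed deduction: for `H` finite with `|H| ∈ k×`
and `k` von Neumann regular, a finitely generated left ideal of `kH` is finitely generated over `k`, hence a `k`-direct summand of the
free `k`-module `kH` (Ex. 6.19), hence a `kH`-direct summand by Maschke's averaging (Ex. 6.3 (1) = the tree's
`exists_isCompl_of_isUnit_card`), so `kH` is von Neumann regular by (4.23); local finiteness reduces `kG` to such `kH`.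

## References

* [Lam2001FirstCourse] T. Y. Lam, *A First Course in Noncommutative Rings*, 2nd ed., Graduate Texts in Mathematics 131, Springer, 2001,
  §6 Exercise 6.21 (with Exercises 6.3 (1), 6.19), p. 98–99 (held scan `book:lamnd-first-course-noncommutative-rings`, p0110–p0111).
-/

universe u w

namespace Literature.Algebra.GroupRings

open MonoidAlgebra Literature.RingTheory.JacobsonRadical

variable {k : Type u} [Ring k]

/-- **Ex. 6.21 «if», finite groups: `k` von Neumann regular, `H` finite with `|H|·1 ∈ k×` ⟹ `kH` von Neumann regular** — a finitely
generated left ideal of `kH` is a `k`-direct summand (Exercise 6.19), hence a `kH`-direct summand (Maschke averaging, Exercise 6.3 (1)).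
[cite: Lam2001FirstCourse, §6 Exercise 6.21, «if»] -/
theorem forall_exists_mul_mul_self_monoidAlgebra_of_finite (hk : ∀ a : k, ∃ x, a * x * a = a) (H : Type w) [Group H] [Finite H]
    (hcard : IsUnit (Nat.card H : k)) : ∀ α : MonoidAlgebra k H, ∃ β, α * β * α = α := by
  haveI : Module.Finite k (MonoidAlgebra k H) := Module.Finite.of_basis (MonoidAlgebra.basis H k)
  refine forall_exists_mul_mul_self_iff_fg_isCompl.2 fun I hI ↦ ?_
  obtain ⟨S, hS⟩ := hI
  have hI' : Submodule.FG I := ⟨S, hS⟩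
  obtain ⟨N, hN⟩ := exists_isCompl_of_fg_of_basis hk (MonoidAlgebra.basis H k) (I.restrictScalars k) hI'.restrictScalars
  exact exists_isCompl_of_isUnit_card k H hcard I ⟨N, hN⟩

/-- **LAM Exercise 6.21, «if» in general: `k` von Neumann regular, `G` locally finite, all finite subgroup orders units in `k` ⟹ `kG`
von Neumann regular** (`α ∈ kH` for the finite subgroup `H` generated by its support). [cite: Lam2001FirstCourse, §6 Exercise 6.21] -/
theorem forall_exists_mul_mul_self_monoidAlgebra {G : Type w} [Group G] (hk : ∀ a : k, ∃ x, a * x * a = a)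
    (hlf : ∀ H : Subgroup G, H.FG → Finite H) (hunit : ∀ H : Subgroup G, Finite H → IsUnit (Nat.card H : k)) :
    ∀ x : MonoidAlgebra k G, ∃ y, x * y * x = x := fun x ↦ by
  obtain ⟨H, hH, α, rfl⟩ := exists_fg_eq_mapDomain x
  haveI : Finite H := hlf H hH
  obtain ⟨β, hβ⟩ := forall_exists_mul_mul_self_monoidAlgebra_of_finite hk H (hunit H inferInstance) α
  exact ⟨mapDomain H.subtype β, by rw [← mapDomain_mul, ← mapDomain_mul, hβ]⟩

/-- **LAM Exercise 6.21 (AUSLANDER, McLAUGHLIN, CONNELL): for a nonzero ring `k` and any group `G`, `kG` is von Neumann regular iff `k`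
is von Neumann regular, `G` is locally finite, and the order of every finite subgroup of `G` is a unit in `k`.**
[cite: Lam2001FirstCourse, §6 Exercise 6.21] -/
theorem forall_exists_mul_mul_self_monoidAlgebra_iff {G : Type w} [Group G] [Nontrivial k] :
    (∀ x : MonoidAlgebra k G, ∃ y, x * y * x = x) ↔
      (∀ a : k, ∃ b, a * b * a = a) ∧ (∀ H : Subgroup G, H.FG → Finite H) ∧ ∀ H : Subgroup G, Finite H → IsUnit (Nat.card H : k) :=
  ⟨vonNeumannRegular_only_if, fun h ↦ forall_exists_mul_mul_self_monoidAlgebra h.1 h.2.1 h.2.2⟩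

end Literature.Algebra.GroupRings
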